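import Mathlib
import Summits.Ventures.PercRepro2.RowC1AvoidRepelTower

/-!
# The `b`-avoiding repulsion: `b ∈ C₂` and «`o` joined to `a₁` avoiding `b`» are negatively
correlated given `a₁ ↮ a₂` (blind cell PercRepro2, p2 g29; proofs/P2-G29-E1.md §2, part 4b)

With `Q = {a₁ ↮ a₂}`, `K₁ = C_{G−b}(a₁)` and `o ∈ K₁` = `avoidConnEvent ends b a₁ o`, for `a₁ ≠ b`:

  **`bH_avoidK1_repel`**: `P(Q, b ∈ C₂, o ∈ K₁) · P(Q) ≤ P(Q, b ∈ C₂) · P(Q, o ∈ K₁)`,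

the `b`-avoiding form of BHK06 Thm 1.4, companion of the attraction `bH_avoidK_attract`
(`RowC1AvoidAttract.lean`).  Proof: explore `K₁`; the tower identities of `RowC1AvoidRepelTower.lean`
write the masses as `E[ρ₁ α₂ 1_{a₂∉K₁}]`, `E[ρ₁ α₂ 1_{o∈K₁} 1_{a₂∉K₁}]`, `E[(ρ₁ + σ₁ ζ₂) 1_{a₂∉K₁}]`,
`E[(ρ₁ + σ₁ ζ₂) 1_{o∈K₁} 1_{a₂∉K₁}]` (`ρ₁ = P(no edge from b into ·)`, `σ₁ = 1 − ρ₁`,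
`ζ₂ = P(b ↮ a₂ in G − ·)`, `α₂ = 1 − ζ₂`); BHK06 Thm 1.1 (`bhk_induced`) on `G` for the cluster of `a₁`
avoiding `{a₂, b}` (functional `ζ₂` against `1[o ∈ ·]`; on that event the cluster is `K₁`) gives
`Z · Pc ≤ Zc · P`, and on `G[V ∖ {b}]` for the cluster of `a₁` avoiding `a₂` (functionals `1 − ρ₁ α₂`
and `σ₁ ζ₂`) gives `X · P₀ ≤ Y · Pc₀` and `S · Pc₀ ≤ T · P₀`; two lines of algebra finish (the cases
`a₂ = b`, `P₀ = 0`, `Pc₀ = 0` separately).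
-/

namespace Summit.Ventures.PercRepro2

namespace RowC1

section MainRepel

variable {V : Type*} {E : Type*} [Fintype E] [DecidableEq E] [Fintype V] [DecidableEq V]
  {R : Type*} [CommRing R] [LinearOrder R] [IsStrictOrderedRing R]

omit [Fintype E] [DecidableEq E] [LinearOrder R] [IsStrictOrderedRing R] in
/-- On `R = {a₁ ↮ a₂} ∩ {a₁ ↮ b}` the cluster of `a₁` in `G` is `K₁`, so a cluster functional times
`1_R` is a functional of `K₁` times `1_R`. -/
lemma clusterObs_univ_mul_REvent_eq (ends : E → Sym2 V) (a₁ a₂ b : V) (F : Set V → R) :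
    (clusterObs ends Finset.univ a₁ F *
        (REvent ends Finset.univ a₁ {a₂, b}).indicator 1 : Config E → R) =
      fun ω => F (avoidCluster ends b a₁ ω) *
        ((connEvent ends a₁ a₂)ᶜ ∩ (connEvent ends a₁ b)ᶜ).indicator 1 ω := by
  funext ω
  have hcl : clusterIn ends Finset.univ a₁ ω = cluster ends ω a₁ := by
    unfold clusterIn
    rw [Finset.coe_univ, induced_univ]
  have hmem : ω ∈ REvent ends Finset.univ a₁ {a₂, b} ↔
      ω ∈ (connEvent ends a₁ a₂)ᶜ ∩ (connEvent ends a₁ b)ᶜ := by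
    rw [mem_REvent]
    simp only [Finset.mem_insert, Finset.mem_singleton, Finset.coe_univ, induced_univ,
      Set.mem_inter_iff, Set.mem_compl_iff, mem_connEvent]
    constructor
    · intro h; exact ⟨h a₂ (Or.inl rfl), h b (Or.inr rfl)⟩
    · rintro ⟨h1, h2⟩ x hx
      rcases hx with rfl | rfl
      · exact h1
      · exact h2
  simp only [Pi.mul_apply, clusterObs_apply, hcl]
  by_cases hR : ω ∈ (connEvent ends a₁ a₂)ᶜ ∩ (connEvent ends a₁ b)ᶜ
  · rw [Set.indicator_of_mem (hmem.2 hR), Set.indicator_of_mem hR,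
      cluster_eq_avoidCluster_of_not_conn hR.2]
  · rw [Set.indicator_of_notMem (fun h => hR (hmem.1 h)), Set.indicator_of_notMem hR]
    simp

omit [Fintype E] [DecidableEq E] [LinearOrder R] [IsStrictOrderedRing R] in
/-- `R^{V}_{\{a₂, b\}}` for the root `a₁` is `{a₁ ↮ a₂} ∩ {a₁ ↮ b}`. -/
lemma REvent_univ_pair_eq (ends : E → Sym2 V) (a₁ a₂ b : V) :
    REvent ends Finset.univ a₁ {a₂, b} = (connEvent ends a₁ a₂)ᶜ ∩ (connEvent ends a₁ b)ᶜ := by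
  ext ω
  rw [mem_REvent]
  simp only [Finset.mem_insert, Finset.mem_singleton, Finset.coe_univ, induced_univ,
    Set.mem_inter_iff, Set.mem_compl_iff, mem_connEvent]
  constructor
  · intro h; exact ⟨h a₂ (Or.inl rfl), h b (Or.inr rfl)⟩
  · rintro ⟨h1, h2⟩ x hx
    rcases hx with rfl | rfl
    · exact h1
    · exact h2

/-- **The `b`-avoiding repulsion** (BHK06 Thm 1.4 for the `b`-avoiding cluster of `a₁`): for
`a₁ ≠ b`, `P(Q, b ∈ C₂, o ∈ K₁) · P(Q) ≤ P(Q, b ∈ C₂) · P(Q, o ∈ K₁)`, where `Q = {a₁ ↮ a₂}` and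
`o ∈ K₁` = `o` joined to `a₁` avoiding `b`. -/
theorem bH_avoidK1_repel (p : E → R) (hp : IsProbVec p) (ends : E → Sym2 V) (a₁ a₂ o b : V)
    (hne : a₁ ≠ b) :
    prob p (connEvent ends a₂ b ∩ avoidConnEvent ends b a₁ o ∩ (connEvent ends a₁ a₂)ᶜ) *
        prob p (connEvent ends a₁ a₂)ᶜ ≤
      prob p (connEvent ends a₂ b ∩ (connEvent ends a₁ a₂)ᶜ) *
        prob p (avoidConnEvent ends b a₁ o ∩ (connEvent ends a₁ a₂)ᶜ) := by
  classical
  -- the degenerate case `a₂ = b`: `{b ∈ C₂}` is everything and the two sides agree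
  by_cases hab2 : a₂ = b
  · subst hab2
    have h0 : connEvent ends a₂ a₂ = Set.univ := by
      ext ω; simp only [mem_connEvent, Set.mem_univ, iff_true]; exact conn_refl _ _ _
    rw [h0, Set.univ_inter, Set.univ_inter, mul_comm]
  set K : Config E → Set V := fun ω => avoidCluster ends b a₁ ω with hK
  set D : Set (Set V) := {W | a₂ ∉ W} with hD
  set C : Set (Set V) := {W | o ∈ W} with hC
  set σ : Set V → R := attachProb p ends b with hσ
  set ρ : Set V → R := noAttachProb p ends b with hρ
  set ζ : Set V → R := delAvoidProb p ends b a₂ with hζ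
  set α : Set V → R := delConnProb p ends b a₂ with hα
  have hoK : avoidConnEvent ends b a₁ o = {ω | K ω ∈ C} := by ext ω; rfl
  have huniv : ({ω | K ω ∈ (Set.univ : Set (Set V))} : Set (Config E)) = Set.univ := by
    ext ω; simp
  -- the four masses as expectations over `K₁`
  have m1 : prob p (connEvent ends a₂ b ∩ (connEvent ends a₁ a₂)ᶜ) =
      expect p (fun ω => ρ (K ω) * α (K ω) * D.indicator 1 (K ω)) := by
    rw [← Set.inter_univ (connEvent ends a₂ b ∩ (connEvent ends a₁ a₂)ᶜ), ← huniv,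
      prob_bH_Q_eq_expect' p ends a₁ a₂ b hne Set.univ]
    refine congrArg _ (funext fun ω => ?_)
    simp only [coeffK, Set.indicator_univ, Pi.one_apply, one_mul]
    ring
  have m2 : prob p (connEvent ends a₂ b ∩ avoidConnEvent ends b a₁ o ∩ (connEvent ends a₁ a₂)ᶜ) =
      expect p (fun ω => ρ (K ω) * α (K ω) * C.indicator 1 (K ω) * D.indicator 1 (K ω)) := by
    rw [hoK, Set.inter_right_comm, prob_bH_Q_eq_expect' p ends a₁ a₂ b hne C]
    refine congrArg _ (funext fun ω => ?_)
    simp only [coeffK]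
    ring
  have m3 : prob p (connEvent ends a₁ a₂)ᶜ =
      expect p (fun ω => (ρ (K ω) + σ (K ω) * ζ (K ω)) * D.indicator 1 (K ω)) := by
    rw [← Set.inter_univ (connEvent ends a₁ a₂)ᶜ, ← huniv,
      prob_Q_eq_expect' p ends a₁ a₂ b hne Set.univ]
    refine congrArg _ (funext fun ω => ?_)
    simp only [coeffK, Set.indicator_univ, Pi.one_apply, one_mul]
    ring
  have m4 : prob p (avoidConnEvent ends b a₁ o ∩ (connEvent ends a₁ a₂)ᶜ) =
      expect p (fun ω => (ρ (K ω) + σ (K ω) * ζ (K ω)) * C.indicator 1 (K ω) *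
        D.indicator 1 (K ω)) := by
    rw [hoK, Set.inter_comm, prob_Q_eq_expect' p ends a₁ a₂ b hne C]
    refine congrArg _ (funext fun ω => ?_)
    simp only [coeffK]
    ring
  -- monotonicity and bounds of the functionals
  have hσmono : Monotone σ := fun W W' h => prob_mono hp (attachEvent_mono b h)
  have hζmono : Monotone ζ := fun W W' h => prob_mono hp (delAvoidEvent_mono b a₂ h)
  have hρanti : Antitone ρ := fun W W' h =>
    prob_mono hp (Set.compl_subset_compl.2 (attachEvent_mono b h))
  have hαanti : Antitone α := fun W W' h =>
    prob_mono hp (Set.compl_subset_compl.2 (delAvoidEvent_mono b a₂ h))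
  have hσ0 : ∀ W, 0 ≤ σ W := fun W => prob_nonneg hp _
  have hζ0 : ∀ W, 0 ≤ ζ W := fun W => prob_nonneg hp _
  have hρ0 : ∀ W, 0 ≤ ρ W := fun W => prob_nonneg hp _
  have hα0 : ∀ W, 0 ≤ α W := fun W => prob_nonneg hp _
  have hρ1 : ∀ W, ρ W ≤ 1 := fun W => prob_le_one hp _
  have hα1 : ∀ W, α W ≤ 1 := fun W => prob_le_one hp _
  have hσ1 : ∀ W, σ W ≤ 1 := fun W => prob_le_one hp _
  have hζ1 : ∀ W, ζ W ≤ 1 := fun W => prob_le_one hp _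
  have hαζ : ∀ W, α W = 1 - ζ W := fun W => delConnProb_eq p ends b a₂ W
  have hρα1 : ∀ W, ρ W * α W ≤ 1 := fun W => mul_le_one₀ (hρ1 W) (hα0 W) (hα1 W)
  have hG₁mono : Monotone (fun W => 1 - ρ W * α W) := fun W W' h => by
    have : ρ W' * α W' ≤ ρ W * α W := mul_le_mul (hρanti h) (hαanti h) (hα0 W') (hρ0 W)
    linarith
  have hG₁0 : ∀ W, 0 ≤ 1 - ρ W * α W := fun W => by linarith [hρα1 W]
  have hG₂mono : Monotone (fun W => σ W * ζ W) := fun W W' h =>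
    mul_le_mul (hσmono h) (hζmono h) (hζ0 W) (hσ0 W')
  have hG₂0 : ∀ W, 0 ≤ σ W * ζ W := fun W => mul_nonneg (hσ0 W) (hζ0 W)
  have hCup : IsUpperSet C := fun W W' h hW => h hW
  have hF₂mono : Monotone (C.indicator (1 : Set V → R)) :=
    monotone_indicator_one_of_isUpperSet (R := R) hCup
  have hF₂0 : ∀ W, 0 ≤ C.indicator (1 : Set V → R) W :=
    fun W => Set.indicator_apply_nonneg fun _ => zero_le_one
  have hD0 : ∀ W, 0 ≤ D.indicator (1 : Set V → R) W :=
    fun W => Set.indicator_apply_nonneg fun _ => zero_le_one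
  have hC1 : ∀ W, C.indicator (1 : Set V → R) W ≤ 1 :=
    fun W => Set.indicator_apply_le' (fun _ => le_rfl) (fun _ => zero_le_one)
  -- (a): BHK on `G` for the cluster of `a₁` avoiding `{a₂, b}`, functional `ζ` against `1_C`
  have hsubU : ({a₂, b} : Finset V) ⊆ Finset.univ := Finset.subset_univ _
  have keyA := bhk_induced p hp ends a₁ hζmono hF₂mono hζ0 hF₂0 Finset.univ {a₂, b} {a₂, b}
    hsubU hsubU
  simp only [Finset.inter_self, Finset.union_self] at keyA
  rw [clusterObs_univ_mul_REvent_eq, clusterObs_univ_mul_REvent_eq,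
    clusterObs_univ_mul_REvent_eq, REvent_univ_pair_eq, prob_eq_expect_indicator] at keyA
  -- the `R`-weighted expectations through the tower with coefficient
  have hRpt : ∀ ω, ω ∈ (connEvent ends a₁ a₂)ᶜ ∩ (connEvent ends a₁ b)ᶜ ↔
      (a₂ ∉ K ω ∧ ω ∈ (attachEvent ends b (K ω))ᶜ) := by
    intro ω
    simp only [Set.mem_inter_iff, Set.mem_compl_iff, mem_connEvent]
    exact (R_iff hne).trans (by simp only [avoidCluster, attachEvent, Set.mem_setOf_eq, hK])
  have hRB : ∀ W, DependsOn (· ∈ (attachEvent ends b W)ᶜ) (touches ends {b} ∪ (touches ends W)ᶜ) :=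
    fun W => (dependsOn_compl (dependsOn_attachEvent b W)).mono
      (Set.inter_subset_left.trans Set.subset_union_left)
  have tower : ∀ c : Set V → R, expect p (fun ω => c (K ω) *
      ((connEvent ends a₁ a₂)ᶜ ∩ (connEvent ends a₁ b)ᶜ).indicator 1 ω) =
      expect p (fun ω => c (K ω) * D.indicator 1 (K ω) * ρ (K ω)) :=
    fun c => expect_avoidCluster_tower p ends a₁ b a₂ c _ (fun W => (attachEvent ends b W)ᶜ) hRB hRpt
  have e1 : expect p (((connEvent ends a₁ a₂)ᶜ ∩ (connEvent ends a₁ b)ᶜ).indicator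
      (1 : Config E → R)) = expect p (fun ω => D.indicator 1 (K ω) * ρ (K ω)) := by
    have := tower (fun _ => 1)
    simp only [one_mul] at this
    exact this
  rw [tower, tower, tower, e1] at keyA
  simp only [Pi.mul_apply] at keyA
  -- atomic expectations
  set P := expect p (fun ω => D.indicator 1 (K ω) * ρ (K ω)) with hP
  set Z := expect p (fun ω => ζ (K ω) * D.indicator 1 (K ω) * ρ (K ω)) with hZ
  set Pc := expect p (fun ω => C.indicator 1 (K ω) * D.indicator 1 (K ω) * ρ (K ω)) with hPc
  set Zc := expect p (fun ω => ζ (K ω) * C.indicator 1 (K ω) * D.indicator 1 (K ω) * ρ (K ω)) with hZc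
  have keyA' : Z * Pc ≤ Zc * P := keyA
  -- (b): BHK on `G[V ∖ {b}]` for the cluster of `a₁` avoiding `a₂`
  have hsub : ({a₂} : Finset V) ⊆ Finset.univ.erase b := by
    intro x hx
    rw [Finset.mem_singleton] at hx
    subst hx
    exact Finset.mem_erase.2 ⟨hab2, Finset.mem_univ _⟩
  have keyB1 := bhk_induced p hp ends a₁ hG₁mono hF₂mono hG₁0 hF₂0 (Finset.univ.erase b) {a₂} {a₂}
    hsub hsub
  have keyB2 := bhk_induced p hp ends a₁ hG₂mono hF₂mono hG₂0 hF₂0 (Finset.univ.erase b) {a₂} {a₂}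
    hsub hsub
  simp only [Finset.inter_self, Finset.union_self] at keyB1 keyB2
  have e2 : ∀ F : Set V → R, (clusterObs ends (Finset.univ.erase b) a₁ F *
      (REvent ends (Finset.univ.erase b) a₁ {a₂}).indicator 1 : Config E → R) =
      fun ω => F (K ω) * D.indicator 1 (K ω) := by
    intro F
    funext ω
    simp only [Pi.mul_apply, clusterObs_apply, clusterIn_erase_eq, REvent_indicator_eq]
    rfl
  have e3 : prob p (REvent ends (Finset.univ.erase b) a₁ {a₂}) =
      expect p (fun ω => D.indicator 1 (K ω)) := by
    rw [prob_eq_expect_indicator]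
    exact congrArg _ (funext fun ω => REvent_indicator_eq ends a₂ a₁ b ω)
  rw [e2, e2, e2, e3] at keyB1 keyB2
  simp only [Pi.mul_apply] at keyB1 keyB2
  set X := expect p (fun ω => ρ (K ω) * α (K ω) * C.indicator 1 (K ω) * D.indicator 1 (K ω)) with hX
  set Y := expect p (fun ω => ρ (K ω) * α (K ω) * D.indicator 1 (K ω)) with hY
  set S := expect p (fun ω => σ (K ω) * ζ (K ω) * D.indicator 1 (K ω)) with hS
  set T := expect p (fun ω => σ (K ω) * ζ (K ω) * C.indicator 1 (K ω) * D.indicator 1 (K ω)) with hT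
  set P₀ := expect p (fun ω => D.indicator 1 (K ω)) with hP₀
  set Pc₀ := expect p (fun ω => C.indicator 1 (K ω) * D.indicator 1 (K ω)) with hPc₀
  -- (i) from `keyB1` with `1 − ρ α`
  have hi : X * P₀ ≤ Y * Pc₀ := by
    have h1 : expect p (fun ω => (1 - ρ (K ω) * α (K ω)) * D.indicator 1 (K ω)) = P₀ - Y := by
      rw [hP₀, hY, ← expect_sub]
      refine congrArg _ (funext fun ω => ?_)
      simp only [Pi.sub_apply]; ring
    have h2 : expect p (fun ω => (1 - ρ (K ω) * α (K ω)) * C.indicator 1 (K ω) *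
        D.indicator 1 (K ω)) = Pc₀ - X := by
      rw [hPc₀, hX, ← expect_sub]
      refine congrArg _ (funext fun ω => ?_)
      simp only [Pi.sub_apply]; ring
    rw [h1, h2] at keyB1
    nlinarith [keyB1]
  have hii : S * Pc₀ ≤ T * P₀ := keyB2
  -- the masses in terms of the atoms
  have hm1 : prob p (connEvent ends a₂ b ∩ (connEvent ends a₁ a₂)ᶜ) = Y := m1
  have hm2 : prob p (connEvent ends a₂ b ∩ avoidConnEvent ends b a₁ o ∩ (connEvent ends a₁ a₂)ᶜ) =
      X := m2
  have hm3 : prob p (connEvent ends a₁ a₂)ᶜ = P + S := by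
    rw [m3, hP, hS, ← expect_add]
    refine congrArg _ (funext fun ω => ?_)
    simp only [Pi.add_apply]; ring
  have hm4 : prob p (avoidConnEvent ends b a₁ o ∩ (connEvent ends a₁ a₂)ᶜ) = Pc + T := by
    rw [m4, hPc, hT, ← expect_add]
    refine congrArg _ (funext fun ω => ?_)
    simp only [Pi.add_apply]; ring
  -- (a): `X * P ≤ Y * Pc` from `keyA'` with `α = 1 − ζ`
  have hXa : X = Pc - Zc := by
    rw [hX, hPc, hZc, ← expect_sub]
    refine congrArg _ (funext fun ω => ?_)
    simp only [Pi.sub_apply, hαζ]; ring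
  have hYa : Y = P - Z := by
    rw [hY, hP, hZ, ← expect_sub]
    refine congrArg _ (funext fun ω => ?_)
    simp only [Pi.sub_apply, hαζ]; ring
  have ha : X * P ≤ Y * Pc := by
    rw [hXa, hYa]; nlinarith [keyA']
  -- nonnegativity / domination for the degenerate cases of (b)
  have hX0 : 0 ≤ X := expect_nonneg hp fun ω =>
    mul_nonneg (mul_nonneg (mul_nonneg (hρ0 _) (hα0 _)) (hF₂0 _)) (hD0 _)
  have hY0 : 0 ≤ Y := expect_nonneg hp fun ω => mul_nonneg (mul_nonneg (hρ0 _) (hα0 _)) (hD0 _)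
  have hT0 : 0 ≤ T := expect_nonneg hp fun ω =>
    mul_nonneg (mul_nonneg (hG₂0 _) (hF₂0 _)) (hD0 _)
  have hP₀0 : 0 ≤ P₀ := expect_nonneg hp fun ω => hD0 _
  have hPc₀0 : 0 ≤ Pc₀ := expect_nonneg hp fun ω => mul_nonneg (hF₂0 _) (hD0 _)
  have hXPc : X ≤ Pc₀ := expect_mono hp fun ω => by
    rw [mul_assoc (ρ (K ω) * α (K ω))]
    exact mul_le_of_le_one_left (mul_nonneg (hF₂0 _) (hD0 _)) (hρα1 _)
  have hPcP : Pc₀ ≤ P₀ := expect_mono hp fun ω => mul_le_of_le_one_left (hD0 _) (hC1 _)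
  have hb : X * S ≤ Y * T := by
    rcases hP₀0.eq_or_lt with hP0' | hPpos
    · have : X = 0 := le_antisymm (by linarith [hXPc, hPcP]) hX0
      rw [this, zero_mul]; exact mul_nonneg hY0 hT0
    · rcases hPc₀0.eq_or_lt with hPc0' | hPcpos
      · have : X = 0 := le_antisymm (by linarith [hXPc]) hX0
        rw [this, zero_mul]; exact mul_nonneg hY0 hT0
      · have hS0 : 0 ≤ S := expect_nonneg hp fun ω => mul_nonneg (hG₂0 _) (hD0 _)
        have h3 : X * S * (P₀ * Pc₀) ≤ Y * T * (P₀ * Pc₀) := by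
          calc X * S * (P₀ * Pc₀) = (X * P₀) * (S * Pc₀) := by ring
            _ ≤ (Y * Pc₀) * (S * Pc₀) := mul_le_mul_of_nonneg_right hi (mul_nonneg hS0 hPc₀0)
            _ ≤ (Y * Pc₀) * (T * P₀) := mul_le_mul_of_nonneg_left hii (mul_nonneg hY0 hPc₀0)
            _ = Y * T * (P₀ * Pc₀) := by ring
        exact le_of_mul_le_mul_right h3 (mul_pos hPpos hPcpos)
  rw [hm1, hm2, hm3, hm4]
  have hsum := add_le_add ha hb
  calc X * (P + S) = X * P + X * S := by ring
    _ ≤ Y * Pc + Y * T := hsum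
    _ = Y * (Pc + T) := by ring

end MainRepel
end RowC1

end Summit.Ventures.PercRepro2
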